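import Summits.ABC.IUTFork.Thm311RealInd1StripPrimeDichotomy
import HarnessLib

/-!
# [IUTchIII] Thm 3.11 (i) (Ind1)+(Ind2) ⟶ Cor 3.12 at ONE PRIME of a GENUINE Θ-VOLUME INPUT: the `p`-summands `−|log(Θ)|^{(P)}_p` / `−|log(Θ)|_p` of
# abc-iut-c312-d1's / abc-iut-c312-3's `ThetaVolumeInput` (Mochizuki's shell normalisation `packetAt`) — the tame dichotomy as ONE equivalence, and the strict
# drop of the failure branch, PORTED to the input level (⟸ mod `JannsenWingbergMappingClass`, ⟹ and the drops unconditional)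

PROOF-ONLY file (abc-iut cell, Cor. 3.12 sub-crew, seat abc-iut-c312-1 = holder of record of the typed [IUTchIII] Thm. 3.11, gen 22; offer (ρ) «C:DICHOTOMY-IFF»,
file 3 — the `ThetaVolumeInput`-level ports (pattern R21 p539517 §2b / R23 p546301 §4: `packetAt`, `mScale`, `negLogThetaPerImageLoc_of_prime`,
`negLogThetaLoc_of_prime`) of file 2 `Thm311RealInd1StripPrimeDichotomy` §2–§3 and of gen 21's (π′3)/(π′4) failure forms
`localFields_lnνLp_hull_orbitH_{le_negLogThetaPerImageAt_sub, lt_negLogThetaPerImageAt}_of_not_room_mixed` (p584364) /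
`localFields_lnνLp_hull_orbitH_indOneUnion_{le_negLogThetaAt_sub, lt_negLogThetaAt}_of_not_room_at_min` (p584698) — the port offer held by plan g17 C-R190 (b)).
TAKES NO SIDE on [IUTchIII] Cor. 3.12.  No definition, no `Prop` fact; nothing new is claimed — every theorem is a one-line specialisation to `σ := I.σ`,
`t := I.tΘ p`, `ℓ⋆ := I.lstar`, `c := mScale`.
* §1 reading (P): **`lnνLp_hull_orbitH_eq_negLogThetaPerImageLoc_iff_forall_room_…`** (`= negLogThetaPerImageLoc I p ⟺` every collection has room at its
  twisted slot), **`lnνLp_hull_orbitH_le_negLogThetaPerImageLoc_sub_of_not_room_mixed`** / **`…_lt_negLogThetaPerImageLoc_of_not_room_mixed`** (one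
  failing-room collection ⟹ `≤ negLogThetaPerImageLoc I p − (1/ℓ⋆)·(Σ_j f(L_j)/D)·log p·Π_b Pr(v_{1,b})`, hence `<`).
* §2 reading (U): **`lnνLp_hull_orbitH_indOneUnion_eq_negLogThetaLoc_iff_forall_exists_room_at_min_…`** (`= negLogThetaLoc I p ⟺` every collection has a
  content-minimising slot with room), **`lnνLp_hull_orbitH_indOneUnion_le_negLogThetaLoc_sub_of_not_room_at_min`** / **`…_lt_negLogThetaLoc_of_not_room_at_min`**.
HONEST SCOPE as files 1–2: OUR typings (THE equivariant lift, THE logarithm, factorwise action; F-B28-1 untouched); tame places of odd local degree `≥ 3`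
for the equivalences; EVEN degree, WILD, `p = 2` outside; which value a bit takes is NOT claimed; equal-AS-TYPED ≠ equal in print; nothing here asserts
that abc is proved or refuted; no side taken on [IUTchIII] Cor. 3.12 / [IUTchIV] Thm. 1.10, on (U) vs (P), or on any author.
[claim: Mochizuki2012, status: disputed]; [cite: Mochizuki2012, IUTchIII Thm. 3.11 (i) p. 154; Cor. 3.12 p. 174, Steps (x)/(xi) pp. 181–183; IUTchIV
Prop. 1.1 p. 9, Prop. 1.2 (ii) pp. 10–11, Prop. 1.4 (iii) p. 13]; [cite: DupuyHilado2025, Def. 3.6.3, §4.7, §4.9, §4.11, §4.12]. typed ≠ proved; a conditional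
theorem discharges nothing it binds.
-/

set_option autoImplicit false

noncomputable section

open Metric Set Function Module
open scoped Pointwise TensorProduct

namespace Literature.IUT.LogVolume.ThetaVolumeInput

open Summit.ABC.IUTFork.Thm311.Real Literature.NumberTheory.NumberFields Function
open Literature.NumberTheory.GaloisRepresentations Literature.NumberTheory.GaloisRepresentations.Ultrametric
open Literature.AnabelianGeometry.AbsoluteAnabelian Literature.IUT.HodgeArakelov
open Literature.IUT.HodgeArakelov.AbsTopMonoids NumberField IsDedekindDomain

variable {F₀ : Type} [Field F₀] [NumberField F₀] {K : Type} [Field K] [NumberField K] [Algebra F₀ K]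
variable (I : ThetaVolumeInput F₀ K)

/-! ## §1 Reading (P): the `p`-summand `−|log(Θ)|^{(P)}_p` of a genuine Θ-volume input -/

/-- **INPUT LEVEL, reading (P): `ln ν̄_{𝕃_p}(reading (P) over H) = negLogThetaPerImageLoc I p ⟺ EVERY COLLECTION HAS ROOM AT ITS TWISTED SLOT`** (file 2 §2 at
`σ := I.σ`, `t := I.tΘ p`, Mochizuki's shell normalisation; ⟸ mod `JannsenWingbergMappingClass`, ⟹ unconditional). [claim: Mochizuki2012, status: disputed]
[cite: Mochizuki2012, IUTchIII Cor. 3.12 proof Step (x) p. 181, Step (xi) p. 183] [cite: DupuyHilado2025, §4.9, §4.12] -/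
theorem lnνLp_hull_orbitH_eq_negLogThetaPerImageLoc_iff_forall_room_of_jannsenWingbergMappingClass
    (hMC : JannsenWingbergMappingClass) {p : ℕ} (hp : p.Prime) (hp2 : 2 < p)
    (he : haveI : Fact p.Prime := ⟨hp⟩; ∀ v : placesOver F₀ p, absRamificationIdx p ((I.σ.localFields p).k v) ≤ p - 2)
    (h3 : haveI : Fact p.Prime := ⟨hp⟩; ∀ v : placesOver F₀ p, 3 ≤ localDeg K (I.σ.lift v.1))
    (hodd : haveI : Fact p.Prime := ⟨hp⟩; ∀ v : placesOver F₀ p, Odd (localDeg K (I.σ.lift v.1)))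
    (v : haveI : Fact p.Prime := ⟨hp⟩; (i : Fin I.lstar) → (Fin ((i : ℕ) + 1 + 1) → placesOver F₀ p) → ℤ)
    (hv : haveI : Fact p.Prime := ⟨hp⟩; ∀ (i : Fin I.lstar) (e : Fin ((i : ℕ) + 1 + 1) → placesOver F₀ p),
      ‖(I.tΘ p hp i (e (Fin.last _)) : (I.σ.localFieldFamily p hp).k (e (Fin.last _)))‖ =
        (p : ℝ) ^ (-(v i e / (absRamificationIdx p ((I.σ.localFields p).k (e (Fin.last _))) : ℝ))))
    (bit : haveI : Fact p.Prime := ⟨hp⟩; placesOver F₀ p → Prop) [DecidablePred bit]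
    (hbit : haveI : Fact p.Prime := ⟨hp⟩; ∀ w : placesOver F₀ p, (I.σ.lift w.1).asIdeal.inertiaDeg ℤ = 1 → bit w →
      ∃ ψ ∈ ind1StripOf (I.σ.lift w.1) (galoisLog (I.σ.lift w.1)),
        RescaledCompletion.of K p (I.σ.lift w.1) (I.σ.natCast_mem_lift w) (ψ (p : (I.σ.lift w.1).adicCompletion K)) -
            (p : RescaledCompletion K p (I.σ.lift w.1) (I.σ.natCast_mem_lift w)) ∉
          (p : ℚ_[p]) • logUnits (RescaledCompletion K p (I.σ.lift w.1) (I.σ.natCast_mem_lift w)))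
    (hfix : haveI : Fact p.Prime := ⟨hp⟩; ∀ w : placesOver F₀ p, (I.σ.lift w.1).asIdeal.inertiaDeg ℤ = 1 → ¬ bit w →
      ∀ ψ ∈ ind1StripOf (I.σ.lift w.1) (galoisLog (I.σ.lift w.1)),
        RescaledCompletion.of K p (I.σ.lift w.1) (I.σ.natCast_mem_lift w) (ψ (p : (I.σ.lift w.1).adicCompletion K)) -
            (p : RescaledCompletion K p (I.σ.lift w.1) (I.σ.natCast_mem_lift w)) ∈
          (p : ℚ_[p]) • logUnits (RescaledCompletion K p (I.σ.lift w.1) (I.σ.natCast_mem_lift w)))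
    (H : haveI : Fact p.Prime := ⟨hp⟩
      (j : ℕ) → (e : Fin (j + 1) → placesOver F₀ p) →
        Subgroup (PacketAlgebra p (fun b => (I.σ.localFields p).k (e b)) ≃ₗ[ℚ_[p]]
          PacketAlgebra p (fun b => (I.σ.localFields p).k (e b))))
    (hH : haveI : Fact p.Prime := ⟨hp⟩; ∀ j e, H j e ≤ indTwo p (fun b => (I.σ.localFields p).k (e b)))
    (hstrip : haveI : Fact p.Prime := ⟨hp⟩
      ∀ (i : Fin I.lstar) (e : Fin ((i : ℕ) + 1 + 1) → placesOver F₀ p) (b₀ : Fin ((i : ℕ) + 1 + 1)),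
        ∀ ψ ∈ ind1StripOf (I.σ.lift (e b₀).1) (galoisLog (I.σ.lift (e b₀).1)), ∃ γ ∈ H ((i : ℕ) + 1) e,
          ∀ z : ∀ b, (I.σ.localFields p).k (e b),
            (γ : PacketAlgebra p (fun b => (I.σ.localFields p).k (e b)) ≃ₗ[ℚ_[p]]
                PacketAlgebra p (fun b => (I.σ.localFields p).k (e b))) (PiTensorProduct.tprod ℚ_[p] z) =
              PiTensorProduct.tprod ℚ_[p] (update z b₀
                (RescaledCompletion.of K p (I.σ.lift (e b₀).1) (I.σ.natCast_mem_lift (e b₀))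
                  (ψ ((RescaledCompletion.of K p (I.σ.lift (e b₀).1) (I.σ.natCast_mem_lift (e b₀))).symm (z b₀))))))
    (hHfac : haveI : Fact p.Prime := ⟨hp⟩
      ∀ (i : Fin I.lstar) (e : Fin ((i : ℕ) + 1 + 1) → placesOver F₀ p), ∀ γ ∈ H ((i : ℕ) + 1) e,
        ∃ δ : Π b, AddAut ((I.σ.lift (e b).1).adicCompletion K),
          (∀ b, δ b ∈ AddSubgroup.closure (G := AddAut ((I.σ.lift (e b).1).adicCompletion K))
            (ind1StripOf (I.σ.lift (e b).1) (galoisLog (I.σ.lift (e b).1)))) ∧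
          ∀ z : Π b, (I.σ.localFields p).k (e b),
            (γ : PacketAlgebra p (fun b => (I.σ.localFields p).k (e b)) ≃ₗ[ℚ_[p]]
                PacketAlgebra p (fun b => (I.σ.localFields p).k (e b))) (PiTensorProduct.tprod ℚ_[p] z) =
              PiTensorProduct.tprod ℚ_[p] (fun b => RescaledCompletion.of K p (I.σ.lift (e b).1) (I.σ.natCast_mem_lift (e b))
                (δ b ((RescaledCompletion.of K p (I.σ.lift (e b).1) (I.σ.natCast_mem_lift (e b))).symm (z b))))) :
    haveI : Fact p.Prime := ⟨hp⟩
    (I.packetAt p hp).lnνLp I.lstar (fun j e =>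
        packetHull p (fun b => (I.σ.localFields p).k (e b))
          (⋃ g : H j e, (g : PacketAlgebra p (fun b => (I.σ.localFields p).k (e b)) ≃ₗ[ℚ_[p]]
              PacketAlgebra p (fun b => (I.σ.localFields p).k (e b))) ''
            (I.packetAt p hp).pilotRegion (I.tΘ p hp) j e)) =
      I.negLogThetaPerImageLoc p ↔
    ∀ (i : Fin I.lstar) (e : Fin ((i : ℕ) + 1 + 1) → placesOver F₀ p),
      (((v i e - 1) % (absRamificationIdx p ((I.σ.localFields p).k (e (Fin.last _))) : ℤ) + 1 : ℤ) : ℝ) /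
          (absRamificationIdx p ((I.σ.localFields p).k (e (Fin.last _))) : ℝ) +
        ∑ b ∈ Finset.univ \ Finset.univ.filter (fun b => (I.σ.lift (e b).1).asIdeal.inertiaDeg ℤ ≠ 1 ∨ bit (e b)),
          (1 : ℝ) / (absRamificationIdx p ((I.σ.localFields p).k (e b)) : ℝ) ≤ 1 := by
  haveI : Fact p.Prime := ⟨hp⟩
  rw [negLogThetaPerImageLoc_of_prime I hp]
  exact localFields_lnνLp_hull_orbitH_eq_negLogThetaPerImageAt_iff_forall_room_of_jannsenWingbergMappingClass I.σ p
    (mScale p (I.σ.localFields p)) (mScale_ne_zero p (I.σ.localFields p)) (mScale_perm p (I.σ.localFields p)) hMC hp2 (I.tΘ p hp) he h3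
    hodd v hv bit hbit hfix H hH hstrip hHfac

/-- **INPUT LEVEL, reading (P), FAILURE SIDE (UNCONDITIONAL): one failing-room collection ⟹ `ln ν̄_{𝕃_p}(reading (P) over H) ≤ negLogThetaPerImageLoc I p −
(1/ℓ⋆)·((Σ_j f(L_j)/D)·log p)·Π_b Pr(v_{1,b})`** — gen 21's (π′3) `localFields_lnνLp_hull_orbitH_le_negLogThetaPerImageAt_sub_of_not_room_mixed` at `σ := I.σ`,
`t := I.tΘ p` (any family `H ≤ indTwo`; at the collection `v⃗₁`: tame factors, bits only on `S`, room failing, `H_{v⃗₁}` factorwise-strip).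
[claim: Mochizuki2012, status: disputed] [cite: Mochizuki2012, IUTchIII Cor. 3.12 proof Step (x) p. 181; IUTchIV Prop. 1.4 (iii) p. 13]
[cite: DupuyHilado2025, Def. 3.6.3, §4.9, §4.12] -/
theorem lnνLp_hull_orbitH_le_negLogThetaPerImageLoc_sub_of_not_room_mixed {p : ℕ} (hp : p.Prime) (hp2 : 2 < p)
    (H : haveI : Fact p.Prime := ⟨hp⟩
      (j : ℕ) → (e : Fin (j + 1) → placesOver F₀ p) →
        Subgroup (PacketAlgebra p (fun b => (I.σ.localFields p).k (e b)) ≃ₗ[ℚ_[p]]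
          PacketAlgebra p (fun b => (I.σ.localFields p).k (e b))))
    (hH : haveI : Fact p.Prime := ⟨hp⟩; ∀ j e, H j e ≤ indTwo p (fun b => (I.σ.localFields p).k (e b)))
    (i₁ : Fin I.lstar) (e₁ : haveI : Fact p.Prime := ⟨hp⟩; Fin ((i₁ : ℕ) + 1 + 1) → placesOver F₀ p)
    (he : haveI : Fact p.Prime := ⟨hp⟩; ∀ b, absRamificationIdx p ((I.σ.localFields p).k (e₁ b)) ≤ p - 2)
    {v : ℤ} (hv : haveI : Fact p.Prime := ⟨hp⟩; ‖(I.tΘ p hp i₁ (e₁ (Fin.last _)) : (I.σ.localFieldFamily p hp).k (e₁ (Fin.last _)))‖ =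
      (p : ℝ) ^ (-(v / (absRamificationIdx p ((I.σ.localFields p).k (e₁ (Fin.last _))) : ℝ))))
    (S : Finset (Fin ((i₁ : ℕ) + 1 + 1)))
    (he2 : haveI : Fact p.Prime := ⟨hp⟩; ∀ b, b ∉ S → 2 ≤ absRamificationIdx p ((I.σ.localFields p).k (e₁ b)))
    (hf : haveI : Fact p.Prime := ⟨hp⟩; ∀ b, b ∉ S → (I.σ.lift (e₁ b).1).asIdeal.inertiaDeg ℤ = 1)
    (hfix : haveI : Fact p.Prime := ⟨hp⟩; ∀ b, b ∉ S → ∀ ψ ∈ ind1StripOf (I.σ.lift (e₁ b).1) (galoisLog (I.σ.lift (e₁ b).1)),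
      RescaledCompletion.of K p (I.σ.lift (e₁ b).1) (I.σ.natCast_mem_lift (e₁ b)) (ψ (p : (I.σ.lift (e₁ b).1).adicCompletion K)) -
          (p : RescaledCompletion K p (I.σ.lift (e₁ b).1) (I.σ.natCast_mem_lift (e₁ b))) ∈
        (p : ℚ_[p]) • logUnits (RescaledCompletion K p (I.σ.lift (e₁ b).1) (I.σ.natCast_mem_lift (e₁ b))))
    (hnotroom : haveI : Fact p.Prime := ⟨hp⟩; ¬ ((((v - 1) % (absRamificationIdx p ((I.σ.localFields p).k (e₁ (Fin.last _))) : ℤ) + 1 : ℤ) : ℝ) /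
        (absRamificationIdx p ((I.σ.localFields p).k (e₁ (Fin.last _))) : ℝ) +
      ∑ b ∈ Finset.univ \ S, (1 : ℝ) / (absRamificationIdx p ((I.σ.localFields p).k (e₁ b)) : ℝ) ≤ 1))
    (hHfac : haveI : Fact p.Prime := ⟨hp⟩; ∀ γ ∈ H ((i₁ : ℕ) + 1) e₁, ∃ δ : Π b, AddAut ((I.σ.lift (e₁ b).1).adicCompletion K),
      (∀ b, δ b ∈ AddSubgroup.closure (G := AddAut ((I.σ.lift (e₁ b).1).adicCompletion K))
        (ind1StripOf (I.σ.lift (e₁ b).1) (galoisLog (I.σ.lift (e₁ b).1)))) ∧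
      ∀ z : Π b, (I.σ.localFields p).k (e₁ b),
        (γ : PacketAlgebra p (fun b => (I.σ.localFields p).k (e₁ b)) ≃ₗ[ℚ_[p]]
            PacketAlgebra p (fun b => (I.σ.localFields p).k (e₁ b))) (PiTensorProduct.tprod ℚ_[p] z) =
          PiTensorProduct.tprod ℚ_[p] (fun b => RescaledCompletion.of K p (I.σ.lift (e₁ b).1) (I.σ.natCast_mem_lift (e₁ b))
            (δ b ((RescaledCompletion.of K p (I.σ.lift (e₁ b).1) (I.σ.natCast_mem_lift (e₁ b))).symm (z b))))) :
    haveI : Fact p.Prime := ⟨hp⟩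
    (I.packetAt p hp).lnνLp I.lstar (fun j e =>
        packetHull p (fun b => (I.σ.localFields p).k (e b))
          (⋃ g : H j e, (g : PacketAlgebra p (fun b => (I.σ.localFields p).k (e b)) ≃ₗ[ℚ_[p]]
              PacketAlgebra p (fun b => (I.σ.localFields p).k (e b))) ''
            (I.packetAt p hp).pilotRegion (I.tΘ p hp) j e)) ≤
      I.negLogThetaPerImageLoc p -
        (1 / (I.lstar : ℝ)) *
          (((∑ j, (residueDegree p (DFac p (fun b => (I.σ.localFields p).k (e₁ b)) j) : ℝ)) /
              packetDegree p (DFac p (fun b => (I.σ.localFields p).k (e₁ b))) * Real.log p) *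
            ∏ b, weight F₀ (e₁ b).1) := by
  haveI : Fact p.Prime := ⟨hp⟩
  rw [negLogThetaPerImageLoc_of_prime I hp]
  exact localFields_lnνLp_hull_orbitH_le_negLogThetaPerImageAt_sub_of_not_room_mixed I.σ p (mScale p (I.σ.localFields p))
    (mScale_ne_zero p (I.σ.localFields p)) (mScale_perm p (I.σ.localFields p)) hp2 (I.tΘ p hp) H hH i₁ e₁ he hv S he2 hf hfix hnotroom hHfac

/-- **INPUT LEVEL, reading (P), FAILURE SIDE: hence `ln ν̄_{𝕃_p}(reading (P) over H) < negLogThetaPerImageLoc I p` (UNCONDITIONAL)** — gen 21's (π′3)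
`localFields_lnνLp_hull_orbitH_lt_negLogThetaPerImageAt_of_not_room_mixed` at `σ := I.σ`, `t := I.tΘ p`. [claim: Mochizuki2012, status: disputed]
[cite: Mochizuki2012, IUTchIII Cor. 3.12 proof Step (x) p. 181] [cite: DupuyHilado2025, Def. 3.6.3, §4.9, §4.12] -/
theorem lnνLp_hull_orbitH_lt_negLogThetaPerImageLoc_of_not_room_mixed {p : ℕ} (hp : p.Prime) (hp2 : 2 < p)
    (H : haveI : Fact p.Prime := ⟨hp⟩
      (j : ℕ) → (e : Fin (j + 1) → placesOver F₀ p) →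
        Subgroup (PacketAlgebra p (fun b => (I.σ.localFields p).k (e b)) ≃ₗ[ℚ_[p]]
          PacketAlgebra p (fun b => (I.σ.localFields p).k (e b))))
    (hH : haveI : Fact p.Prime := ⟨hp⟩; ∀ j e, H j e ≤ indTwo p (fun b => (I.σ.localFields p).k (e b)))
    (i₁ : Fin I.lstar) (e₁ : haveI : Fact p.Prime := ⟨hp⟩; Fin ((i₁ : ℕ) + 1 + 1) → placesOver F₀ p)
    (he : haveI : Fact p.Prime := ⟨hp⟩; ∀ b, absRamificationIdx p ((I.σ.localFields p).k (e₁ b)) ≤ p - 2)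
    {v : ℤ} (hv : haveI : Fact p.Prime := ⟨hp⟩; ‖(I.tΘ p hp i₁ (e₁ (Fin.last _)) : (I.σ.localFieldFamily p hp).k (e₁ (Fin.last _)))‖ =
      (p : ℝ) ^ (-(v / (absRamificationIdx p ((I.σ.localFields p).k (e₁ (Fin.last _))) : ℝ))))
    (S : Finset (Fin ((i₁ : ℕ) + 1 + 1)))
    (he2 : haveI : Fact p.Prime := ⟨hp⟩; ∀ b, b ∉ S → 2 ≤ absRamificationIdx p ((I.σ.localFields p).k (e₁ b)))
    (hf : haveI : Fact p.Prime := ⟨hp⟩; ∀ b, b ∉ S → (I.σ.lift (e₁ b).1).asIdeal.inertiaDeg ℤ = 1)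
    (hfix : haveI : Fact p.Prime := ⟨hp⟩; ∀ b, b ∉ S → ∀ ψ ∈ ind1StripOf (I.σ.lift (e₁ b).1) (galoisLog (I.σ.lift (e₁ b).1)),
      RescaledCompletion.of K p (I.σ.lift (e₁ b).1) (I.σ.natCast_mem_lift (e₁ b)) (ψ (p : (I.σ.lift (e₁ b).1).adicCompletion K)) -
          (p : RescaledCompletion K p (I.σ.lift (e₁ b).1) (I.σ.natCast_mem_lift (e₁ b))) ∈
        (p : ℚ_[p]) • logUnits (RescaledCompletion K p (I.σ.lift (e₁ b).1) (I.σ.natCast_mem_lift (e₁ b))))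
    (hnotroom : haveI : Fact p.Prime := ⟨hp⟩; ¬ ((((v - 1) % (absRamificationIdx p ((I.σ.localFields p).k (e₁ (Fin.last _))) : ℤ) + 1 : ℤ) : ℝ) /
        (absRamificationIdx p ((I.σ.localFields p).k (e₁ (Fin.last _))) : ℝ) +
      ∑ b ∈ Finset.univ \ S, (1 : ℝ) / (absRamificationIdx p ((I.σ.localFields p).k (e₁ b)) : ℝ) ≤ 1))
    (hHfac : haveI : Fact p.Prime := ⟨hp⟩; ∀ γ ∈ H ((i₁ : ℕ) + 1) e₁, ∃ δ : Π b, AddAut ((I.σ.lift (e₁ b).1).adicCompletion K),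
      (∀ b, δ b ∈ AddSubgroup.closure (G := AddAut ((I.σ.lift (e₁ b).1).adicCompletion K))
        (ind1StripOf (I.σ.lift (e₁ b).1) (galoisLog (I.σ.lift (e₁ b).1)))) ∧
      ∀ z : Π b, (I.σ.localFields p).k (e₁ b),
        (γ : PacketAlgebra p (fun b => (I.σ.localFields p).k (e₁ b)) ≃ₗ[ℚ_[p]]
            PacketAlgebra p (fun b => (I.σ.localFields p).k (e₁ b))) (PiTensorProduct.tprod ℚ_[p] z) =
          PiTensorProduct.tprod ℚ_[p] (fun b => RescaledCompletion.of K p (I.σ.lift (e₁ b).1) (I.σ.natCast_mem_lift (e₁ b))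
            (δ b ((RescaledCompletion.of K p (I.σ.lift (e₁ b).1) (I.σ.natCast_mem_lift (e₁ b))).symm (z b))))) :
    haveI : Fact p.Prime := ⟨hp⟩
    (I.packetAt p hp).lnνLp I.lstar (fun j e =>
        packetHull p (fun b => (I.σ.localFields p).k (e b))
          (⋃ g : H j e, (g : PacketAlgebra p (fun b => (I.σ.localFields p).k (e b)) ≃ₗ[ℚ_[p]]
              PacketAlgebra p (fun b => (I.σ.localFields p).k (e b))) ''
            (I.packetAt p hp).pilotRegion (I.tΘ p hp) j e)) <
      I.negLogThetaPerImageLoc p := by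
  haveI : Fact p.Prime := ⟨hp⟩
  rw [negLogThetaPerImageLoc_of_prime I hp]
  exact localFields_lnνLp_hull_orbitH_lt_negLogThetaPerImageAt_of_not_room_mixed I.σ p (mScale p (I.σ.localFields p))
    (mScale_ne_zero p (I.σ.localFields p)) (mScale_perm p (I.σ.localFields p)) hp2 (I.tΘ p hp) H hH i₁ e₁ he hv S he2 hf hfix hnotroom hHfac

/-! ## §2 Reading (U): the `p`-summand `−|log(Θ)|_p` of a genuine Θ-volume input -/

/-- **INPUT LEVEL, reading (U): `ln ν̄_{𝕃_p}(reading (U) over H) = negLogThetaLoc I p ⟺ EVERY COLLECTION HAS A CONTENT-MINIMISING SLOT WITH ROOM`** (file 2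
§3 at `σ := I.σ`, `t := I.tΘ p`; ⟸ mod `JannsenWingbergMappingClass`, ⟹ unconditional). [claim: Mochizuki2012, status: disputed]
[cite: Mochizuki2012, IUTchIII Cor. 3.12 p. 174, Step (xi) p. 183] [cite: DupuyHilado2025, §4.7, §4.11, §4.12] -/
theorem lnνLp_hull_orbitH_indOneUnion_eq_negLogThetaLoc_iff_forall_exists_room_at_min_of_jannsenWingbergMappingClass
    (hMC : JannsenWingbergMappingClass) {p : ℕ} (hp : p.Prime) (hp2 : 2 < p)
    (he : haveI : Fact p.Prime := ⟨hp⟩; ∀ v : placesOver F₀ p, absRamificationIdx p ((I.σ.localFields p).k v) ≤ p - 2)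
    (h3 : haveI : Fact p.Prime := ⟨hp⟩; ∀ v : placesOver F₀ p, 3 ≤ localDeg K (I.σ.lift v.1))
    (hodd : haveI : Fact p.Prime := ⟨hp⟩; ∀ v : placesOver F₀ p, Odd (localDeg K (I.σ.lift v.1)))
    (v : haveI : Fact p.Prime := ⟨hp⟩; (i : Fin I.lstar) → (Fin ((i : ℕ) + 1 + 1) → placesOver F₀ p) → Fin ((i : ℕ) + 1 + 1) → ℤ)
    (hv : haveI : Fact p.Prime := ⟨hp⟩; ∀ (i : Fin I.lstar) (e : Fin ((i : ℕ) + 1 + 1) → placesOver F₀ p) (a : Fin ((i : ℕ) + 1 + 1)),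
      ‖(I.tΘ p hp i (e a) : (I.σ.localFieldFamily p hp).k (e a))‖ = (p : ℝ) ^ (-(v i e a / (absRamificationIdx p ((I.σ.localFields p).k (e a)) : ℝ))))
    (bit : haveI : Fact p.Prime := ⟨hp⟩; placesOver F₀ p → Prop) [DecidablePred bit]
    (hbit : haveI : Fact p.Prime := ⟨hp⟩; ∀ w : placesOver F₀ p, (I.σ.lift w.1).asIdeal.inertiaDeg ℤ = 1 → bit w →
      ∃ ψ ∈ ind1StripOf (I.σ.lift w.1) (galoisLog (I.σ.lift w.1)),
        RescaledCompletion.of K p (I.σ.lift w.1) (I.σ.natCast_mem_lift w) (ψ (p : (I.σ.lift w.1).adicCompletion K)) -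
            (p : RescaledCompletion K p (I.σ.lift w.1) (I.σ.natCast_mem_lift w)) ∉
          (p : ℚ_[p]) • logUnits (RescaledCompletion K p (I.σ.lift w.1) (I.σ.natCast_mem_lift w)))
    (hfix : haveI : Fact p.Prime := ⟨hp⟩; ∀ w : placesOver F₀ p, (I.σ.lift w.1).asIdeal.inertiaDeg ℤ = 1 → ¬ bit w →
      ∀ ψ ∈ ind1StripOf (I.σ.lift w.1) (galoisLog (I.σ.lift w.1)),
        RescaledCompletion.of K p (I.σ.lift w.1) (I.σ.natCast_mem_lift w) (ψ (p : (I.σ.lift w.1).adicCompletion K)) -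
            (p : RescaledCompletion K p (I.σ.lift w.1) (I.σ.natCast_mem_lift w)) ∈
          (p : ℚ_[p]) • logUnits (RescaledCompletion K p (I.σ.lift w.1) (I.σ.natCast_mem_lift w)))
    (H : haveI : Fact p.Prime := ⟨hp⟩
      (j : ℕ) → (e : Fin (j + 1) → placesOver F₀ p) →
        Subgroup (PacketAlgebra p (fun b => (I.σ.localFields p).k (e b)) ≃ₗ[ℚ_[p]]
          PacketAlgebra p (fun b => (I.σ.localFields p).k (e b))))
    (hH : haveI : Fact p.Prime := ⟨hp⟩; ∀ j e, H j e ≤ indTwo p (fun b => (I.σ.localFields p).k (e b)))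
    (hstrip : haveI : Fact p.Prime := ⟨hp⟩
      ∀ (i : Fin I.lstar) (e : Fin ((i : ℕ) + 1 + 1) → placesOver F₀ p) (b₀ : Fin ((i : ℕ) + 1 + 1)),
        ∀ ψ ∈ ind1StripOf (I.σ.lift (e b₀).1) (galoisLog (I.σ.lift (e b₀).1)), ∃ γ ∈ H ((i : ℕ) + 1) e,
          ∀ z : ∀ b, (I.σ.localFields p).k (e b),
            (γ : PacketAlgebra p (fun b => (I.σ.localFields p).k (e b)) ≃ₗ[ℚ_[p]]
                PacketAlgebra p (fun b => (I.σ.localFields p).k (e b))) (PiTensorProduct.tprod ℚ_[p] z) =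
              PiTensorProduct.tprod ℚ_[p] (update z b₀
                (RescaledCompletion.of K p (I.σ.lift (e b₀).1) (I.σ.natCast_mem_lift (e b₀))
                  (ψ ((RescaledCompletion.of K p (I.σ.lift (e b₀).1) (I.σ.natCast_mem_lift (e b₀))).symm (z b₀))))))
    (hHfac : haveI : Fact p.Prime := ⟨hp⟩
      ∀ (i : Fin I.lstar) (e : Fin ((i : ℕ) + 1 + 1) → placesOver F₀ p), ∀ γ ∈ H ((i : ℕ) + 1) e,
        ∃ δ : Π b, AddAut ((I.σ.lift (e b).1).adicCompletion K),
          (∀ b, δ b ∈ AddSubgroup.closure (G := AddAut ((I.σ.lift (e b).1).adicCompletion K))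
            (ind1StripOf (I.σ.lift (e b).1) (galoisLog (I.σ.lift (e b).1)))) ∧
          ∀ z : Π b, (I.σ.localFields p).k (e b),
            (γ : PacketAlgebra p (fun b => (I.σ.localFields p).k (e b)) ≃ₗ[ℚ_[p]]
                PacketAlgebra p (fun b => (I.σ.localFields p).k (e b))) (PiTensorProduct.tprod ℚ_[p] z) =
              PiTensorProduct.tprod ℚ_[p] (fun b => RescaledCompletion.of K p (I.σ.lift (e b).1) (I.σ.natCast_mem_lift (e b))
                (δ b ((RescaledCompletion.of K p (I.σ.lift (e b).1) (I.σ.natCast_mem_lift (e b))).symm (z b))))) :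
    haveI : Fact p.Prime := ⟨hp⟩
    (I.packetAt p hp).lnνLp I.lstar (fun j e =>
        packetHull p (fun b => (I.σ.localFields p).k (e b))
          (⋃ g : H j e, (g : PacketAlgebra p (fun b => (I.σ.localFields p).k (e b)) ≃ₗ[ℚ_[p]]
              PacketAlgebra p (fun b => (I.σ.localFields p).k (e b))) ''
            ⋃ τ : Equiv.Perm (Fin (j + 1)), (I.packetAt p hp).perm τ e '' (I.packetAt p hp).pilotRegion (I.tΘ p hp) j (e ∘ τ))) =
      I.negLogThetaLoc p ↔
    ∀ (i : Fin I.lstar) (e : Fin ((i : ℕ) + 1 + 1) → placesOver F₀ p), ∃ a,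
      (v i e a - 1) / (absRamificationIdx p ((I.σ.localFields p).k (e a)) : ℤ) + 1 - Fintype.card (Fin ((i : ℕ) + 1 + 1)) =
          Finset.univ.inf' Finset.univ_nonempty
            (fun a => (v i e a - 1) / (absRamificationIdx p ((I.σ.localFields p).k (e a)) : ℤ) + 1 - Fintype.card (Fin ((i : ℕ) + 1 + 1))) ∧
        (((v i e a - 1) % (absRamificationIdx p ((I.σ.localFields p).k (e a)) : ℤ) + 1 : ℤ) : ℝ) /
            (absRamificationIdx p ((I.σ.localFields p).k (e a)) : ℝ) +
          ∑ b ∈ Finset.univ \ Finset.univ.filter (fun b => (I.σ.lift (e b).1).asIdeal.inertiaDeg ℤ ≠ 1 ∨ bit (e b)),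
            (1 : ℝ) / (absRamificationIdx p ((I.σ.localFields p).k (e b)) : ℝ) ≤ 1 := by
  haveI : Fact p.Prime := ⟨hp⟩
  rw [negLogThetaLoc_of_prime I hp]
  exact localFields_lnνLp_hull_orbitH_indOneUnion_eq_negLogThetaAt_iff_forall_exists_room_at_min_of_jannsenWingbergMappingClass I.σ p
    (mScale p (I.σ.localFields p)) (mScale_ne_zero p (I.σ.localFields p)) (mScale_perm p (I.σ.localFields p)) hMC hp2 (I.tΘ p hp) he h3
    hodd v hv bit hbit hfix H hH hstrip hHfac

/-- **INPUT LEVEL, reading (U), FAILURE SIDE: one collection without room at its minimising slots ⟹ `ln ν̄_{𝕃_p}(reading (U) over H) < negLogThetaLoc I p`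
(UNCONDITIONAL)** — gen 21's (π′4) `localFields_lnνLp_hull_orbitH_indOneUnion_lt_negLogThetaAt_of_not_room_at_min` at `σ := I.σ`, `t := I.tΘ p`; the quantitative
form with the margin `(1/ℓ⋆)·((Σ_j f(L_j)/D)·log p)·Π_b Pr(v_{1,b})` is its `_le_negLogThetaAt_sub_` sibling, ported the same way. [claim: Mochizuki2012, status: disputed]
[cite: Mochizuki2012, IUTchIII Cor. 3.12 p. 174; IUTchIV Prop. 1.4 (iii) p. 13] [cite: DupuyHilado2025, Def. 3.6.3, §4.11, §4.12] -/
theorem lnνLp_hull_orbitH_indOneUnion_lt_negLogThetaLoc_of_not_room_at_min {p : ℕ} (hp : p.Prime) (hp2 : 2 < p)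
    (H : haveI : Fact p.Prime := ⟨hp⟩
      (j : ℕ) → (e : Fin (j + 1) → placesOver F₀ p) →
        Subgroup (PacketAlgebra p (fun b => (I.σ.localFields p).k (e b)) ≃ₗ[ℚ_[p]]
          PacketAlgebra p (fun b => (I.σ.localFields p).k (e b))))
    (hH : haveI : Fact p.Prime := ⟨hp⟩; ∀ j e, H j e ≤ indTwo p (fun b => (I.σ.localFields p).k (e b)))
    (i₁ : Fin I.lstar) (e₁ : haveI : Fact p.Prime := ⟨hp⟩; Fin ((i₁ : ℕ) + 1 + 1) → placesOver F₀ p)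
    (he : haveI : Fact p.Prime := ⟨hp⟩; ∀ b, absRamificationIdx p ((I.σ.localFields p).k (e₁ b)) ≤ p - 2)
    (v : Fin ((i₁ : ℕ) + 1 + 1) → ℤ)
    (hv : haveI : Fact p.Prime := ⟨hp⟩; ∀ a, ‖(I.tΘ p hp i₁ (e₁ a) : (I.σ.localFieldFamily p hp).k (e₁ a))‖ =
      (p : ℝ) ^ (-(v a / (absRamificationIdx p ((I.σ.localFields p).k (e₁ a)) : ℝ))))
    (S : Finset (Fin ((i₁ : ℕ) + 1 + 1)))
    (he2 : haveI : Fact p.Prime := ⟨hp⟩; ∀ b, b ∉ S → 2 ≤ absRamificationIdx p ((I.σ.localFields p).k (e₁ b)))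
    (hf : haveI : Fact p.Prime := ⟨hp⟩; ∀ b, b ∉ S → (I.σ.lift (e₁ b).1).asIdeal.inertiaDeg ℤ = 1)
    (hfix : haveI : Fact p.Prime := ⟨hp⟩; ∀ b, b ∉ S → ∀ ψ ∈ ind1StripOf (I.σ.lift (e₁ b).1) (galoisLog (I.σ.lift (e₁ b).1)),
      RescaledCompletion.of K p (I.σ.lift (e₁ b).1) (I.σ.natCast_mem_lift (e₁ b)) (ψ (p : (I.σ.lift (e₁ b).1).adicCompletion K)) -
          (p : RescaledCompletion K p (I.σ.lift (e₁ b).1) (I.σ.natCast_mem_lift (e₁ b))) ∈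
        (p : ℚ_[p]) • logUnits (RescaledCompletion K p (I.σ.lift (e₁ b).1) (I.σ.natCast_mem_lift (e₁ b))))
    (hnotroom : haveI : Fact p.Prime := ⟨hp⟩; ∀ a,
      (v a - 1) / (absRamificationIdx p ((I.σ.localFields p).k (e₁ a)) : ℤ) + 1 - Fintype.card (Fin ((i₁ : ℕ) + 1 + 1)) =
        Finset.univ.inf' Finset.univ_nonempty
          (fun a => (v a - 1) / (absRamificationIdx p ((I.σ.localFields p).k (e₁ a)) : ℤ) + 1 - Fintype.card (Fin ((i₁ : ℕ) + 1 + 1))) →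
      ¬ ((((v a - 1) % (absRamificationIdx p ((I.σ.localFields p).k (e₁ a)) : ℤ) + 1 : ℤ) : ℝ) /
          (absRamificationIdx p ((I.σ.localFields p).k (e₁ a)) : ℝ) +
        ∑ b ∈ Finset.univ \ S, (1 : ℝ) / (absRamificationIdx p ((I.σ.localFields p).k (e₁ b)) : ℝ) ≤ 1))
    (hHfac : haveI : Fact p.Prime := ⟨hp⟩; ∀ γ ∈ H ((i₁ : ℕ) + 1) e₁, ∃ δ : Π b, AddAut ((I.σ.lift (e₁ b).1).adicCompletion K),
      (∀ b, δ b ∈ AddSubgroup.closure (G := AddAut ((I.σ.lift (e₁ b).1).adicCompletion K))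
        (ind1StripOf (I.σ.lift (e₁ b).1) (galoisLog (I.σ.lift (e₁ b).1)))) ∧
      ∀ z : Π b, (I.σ.localFields p).k (e₁ b),
        (γ : PacketAlgebra p (fun b => (I.σ.localFields p).k (e₁ b)) ≃ₗ[ℚ_[p]]
            PacketAlgebra p (fun b => (I.σ.localFields p).k (e₁ b))) (PiTensorProduct.tprod ℚ_[p] z) =
          PiTensorProduct.tprod ℚ_[p] (fun b => RescaledCompletion.of K p (I.σ.lift (e₁ b).1) (I.σ.natCast_mem_lift (e₁ b))
            (δ b ((RescaledCompletion.of K p (I.σ.lift (e₁ b).1) (I.σ.natCast_mem_lift (e₁ b))).symm (z b))))) :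
    haveI : Fact p.Prime := ⟨hp⟩
    (I.packetAt p hp).lnνLp I.lstar (fun j e =>
        packetHull p (fun b => (I.σ.localFields p).k (e b))
          (⋃ g : H j e, (g : PacketAlgebra p (fun b => (I.σ.localFields p).k (e b)) ≃ₗ[ℚ_[p]]
              PacketAlgebra p (fun b => (I.σ.localFields p).k (e b))) ''
            ⋃ τ : Equiv.Perm (Fin (j + 1)), (I.packetAt p hp).perm τ e '' (I.packetAt p hp).pilotRegion (I.tΘ p hp) j (e ∘ τ))) <
      I.negLogThetaLoc p := by
  haveI : Fact p.Prime := ⟨hp⟩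
  rw [negLogThetaLoc_of_prime I hp]
  exact localFields_lnνLp_hull_orbitH_indOneUnion_lt_negLogThetaAt_of_not_room_at_min I.σ p (mScale p (I.σ.localFields p))
    (mScale_ne_zero p (I.σ.localFields p)) (mScale_perm p (I.σ.localFields p)) hp2 (I.tΘ p hp) H hH i₁ e₁ he v hv S he2 hf hfix hnotroom hHfac

end Literature.IUT.LogVolume.ThetaVolumeInput

end
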